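import Literature.NumberTheory.LFunctions.WeilFinitePrimeQuadratic
import Mathlib.Analysis.SpecialFunctions.ImproperIntegrals
import HarnessLib

/-!
# RiemannHypothesis / GroundBarta — crux `PolarPerronFrobenius` (stmt-RiemannHypothesis-18390):
# the PRIME-TRUNCATION BARRIER, part 1/3 — a uniform CONE GAP for every finite-prime truncation

Helper file (`--supports`), RH-free, Mathlib + proved tree files only, no definitions.

For the finite-prime analytic form `E_N` of Weil's windowed quadratic functional
(`Literature.NumberTheory.LFunctions.weilFinitePrimeQuadratic`: polar + archimedean − the prime powers `n ≤ N`,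
frequency side `w_N(t) = Re ψ(1/4+it/2) − Σ_{n≤N} (Λ(n)/√n) 2cos(t log n)`; `N ≤ 1` is Yoshida's prime-free
form `weilArchQuadratic`), every REAL NON-NEGATIVE test `g` (any support) satisfies

`E_N(g) ≥ (ψ(1/4) − log π + 24/5 − 2Ψ_N) ‖g‖₂²`, `Ψ_N = Σ_{n≤N} Λ(n)/√n`
(`pt_weilFinitePrimeQuadratic_ge_of_nonneg`; prime-free case `pt_weilArchQuadratic_ge_of_nonneg`:
`E(g) ≥ (ψ(1/4) − log π + 24/5)‖g‖² ≥ −0.5722 ‖g‖²`),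

whereas `inf_t w_N(t) − log π = ψ(1/4) − log π − 2Ψ_N` is the bottom of the symbol, which spread SIGN-CHANGING
even tests approach as the window grows (part 2).  Mechanism: for `g ≥ 0` the transform is dominated by its
value at the real point, `|ĝ(1/2+it)| ≤ ĝ(1/2) = ∫ g`, and the polar term is `2ĝ(0)ĝ(1) ≥ 2(∫g)²`
(Cauchy–Schwarz); the digamma symbol exceeds its minimum by `f_{1/2}(t) + f_{5/2}(t)`
(`f_l(t) = 2/l − 2l/(l²+t²)`, Yoshida's vertical series), and each Lorentzian costs at most `(∫g)²`
(`∫ 2l/(l²+t²) dt = 2π`), paid for by the polar term.  So the pole PENALISES one-signed states uniformly, at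
every window and for every finite set of primes: Perron–Frobenius persistence for the truncated forms must
fail at large windows (part 3), i.e. cofinal one-signedness of Weil ground states (the crux) is invisible to
any fixed finite prime truncation.
Prover B, speedrun unit `sr-gb-rung-b` (rung 3).

References: H. Yoshida, Adv. Stud. Pure Math. 21 (1992) §2 (2.1), §6 (vertical series);
E. Bombieri, Rend. Lincei (9) 11 (2000) Thm 2.
-/

set_option linter.dupNamespace false

noncomputable section

open Set MeasureTheory Filter Complex
open scoped Real Topology ComplexConjugate

namespace Summit.RiemannHypothesis.RiemannHypothesis.Theorems.PolarPerronFrobenius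

open Literature.NumberTheory.LFunctions Literature.Analysis.SpecialFunctions

variable {g : ℝ → ℂ}

/-! ## The truncated prime ripple is bounded by twice the total prime weight -/

/-- `|ρ_N(t)| ≤ 2Ψ_N`, `Ψ_N = Σ_{n≤N} Λ(n)/√n` (`|2cos| ≤ 2`, `Λ(n)/√n ≥ 0`). [folklore] -/
theorem pt_abs_weilPrimeRipple_le (N : ℕ) (t : ℝ) :
    |weilPrimeRipple N t| ≤
      2 * ∑ n ∈ Finset.range (N + 1), (ArithmeticFunction.vonMangoldt n : ℝ) / Real.sqrt n := by
  unfold weilPrimeRipple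
  rw [Finset.mul_sum]
  refine (Finset.abs_sum_le_sum_abs _ _).trans (Finset.sum_le_sum fun n _ ↦ ?_)
  have h0 : 0 ≤ (ArithmeticFunction.vonMangoldt n : ℝ) / Real.sqrt n :=
    div_nonneg ArithmeticFunction.vonMangoldt_nonneg (Real.sqrt_nonneg _)
  rw [abs_mul, abs_of_nonneg h0]
  have hc : |2 * Real.cos (t * Real.log n)| ≤ 2 := by
    rw [abs_mul, abs_of_pos (by norm_num : (0:ℝ) < 2)]
    have := Real.abs_cos_le_one (t * Real.log n)
    linarith
  calc (ArithmeticFunction.vonMangoldt n : ℝ) / Real.sqrt n * |2 * Real.cos (t * Real.log n)|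
      ≤ (ArithmeticFunction.vonMangoldt n : ℝ) / Real.sqrt n * 2 :=
        mul_le_mul_of_nonneg_left hc h0
    _ = 2 * ((ArithmeticFunction.vonMangoldt n : ℝ) / Real.sqrt n) := by ring

/-! ## Transforms of real non-negative tests -/

/-- A real non-negative test is the cast of its real part. [folklore] -/
theorem pt_eq_ofReal_re (hreal : ∀ t, (g t).im = 0 ∧ 0 ≤ (g t).re) (t : ℝ) :
    g t = (((g t).re : ℝ) : ℂ) := by
  apply Complex.ext <;> simp [(hreal t).1]

/-- `‖g t‖ = Re g(t)` for a real non-negative test. [folklore] -/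
theorem pt_norm_eq_re (hreal : ∀ t, (g t).im = 0 ∧ 0 ≤ (g t).re) (t : ℝ) :
    ‖g t‖ = (g t).re := by
  rw [pt_eq_ofReal_re hreal t, Complex.norm_real, Real.norm_of_nonneg (hreal t).2]
  simp

/-- **Positivity dominates the transform**: `‖ĝ(1/2 + it)‖ ≤ ∫ Re g` for a real non-negative test
(`|∫ g e^{itx}| ≤ ∫ |g| = ∫ g`). [folklore] -/
theorem pt_norm_weilMellin_half_line_le (hreal : ∀ t, (g t).im = 0 ∧ 0 ≤ (g t).re) (t : ℝ) :
    ‖weilMellin g (1 / 2 + t * I)‖ ≤ ∫ x : ℝ, (g x).re := by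
  unfold weilMellin
  refine (norm_integral_le_integral_norm _).trans (le_of_eq ?_)
  congr 1 with x
  rw [norm_mul, show ((1 / 2 : ℂ) + t * I - 1 / 2) * x = ((t * x : ℝ) : ℂ) * I by push_cast; ring,
    Complex.norm_exp_ofReal_mul_I, mul_one, pt_norm_eq_re hreal]

/-- `ĝ(0) = ∫ Re g(x) e^{-x/2} dx` (a real number) for a real non-negative test. [folklore] -/
theorem pt_weilMellin_zero_eq (hreal : ∀ t, (g t).im = 0 ∧ 0 ≤ (g t).re) :
    weilMellin g 0 = ((∫ x : ℝ, (g x).re * Real.exp (-(x / 2)) : ℝ) : ℂ) := by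
  unfold weilMellin
  rw [← integral_complex_ofReal]
  congr 1 with x
  rw [pt_eq_ofReal_re hreal x]
  push_cast
  simp only [Complex.ofReal_re]
  congr 1
  ring

/-- `ĝ(1) = ∫ Re g(x) e^{x/2} dx` (a real number) for a real non-negative test. [folklore] -/
theorem pt_weilMellin_one_eq (hreal : ∀ t, (g t).im = 0 ∧ 0 ≤ (g t).re) :
    weilMellin g 1 = ((∫ x : ℝ, (g x).re * Real.exp (x / 2) : ℝ) : ℂ) := by
  unfold weilMellin
  rw [← integral_complex_ofReal]
  congr 1 with x
  rw [pt_eq_ofReal_re hreal x]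
  push_cast
  simp only [Complex.ofReal_re]
  congr 1
  ring


/-! ## The polar term of a non-negative test: `2 ĝ(0) ĝ(1) ≥ 2 (∫ g)²` -/

/-- `x ↦ Re g(x) φ(x)` is integrable for continuous `φ`. [folklore] -/
theorem pt_integrable_re_mul (hg : IsWeilTest g) {φ : ℝ → ℝ} (hφ : Continuous φ) :
    Integrable fun x : ℝ ↦ (g x).re * φ x := by
  refine Continuous.integrable_of_hasCompactSupport ((Complex.continuous_re.comp hg.1.continuous).mul hφ) ?_
  exact (hg.2.comp_left (g := Complex.re) Complex.zero_re).mul_right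

/-- `Re g` is integrable. [folklore] -/
theorem pt_integrable_re (hg : IsWeilTest g) : Integrable fun x : ℝ ↦ (g x).re := by
  simpa using pt_integrable_re_mul hg continuous_const (φ := fun _ ↦ (1 : ℝ))

/-- **Cauchy–Schwarz for the polar weights**: `(∫ g)² ≤ (∫ g e^{-x/2}) (∫ g e^{x/2})` for a real
non-negative test (the quadratic `λ ↦ ∫ g (λe^{-x/4} − e^{x/4})² ≥ 0` has non-positive discriminant). [folklore] -/
theorem pt_sq_integral_re_le (hg : IsWeilTest g) (hreal : ∀ t, (g t).im = 0 ∧ 0 ≤ (g t).re) :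
    (∫ x : ℝ, (g x).re) ^ 2 ≤
      (∫ x : ℝ, (g x).re * Real.exp (-(x / 2))) * (∫ x : ℝ, (g x).re * Real.exp (x / 2)) := by
  set A := ∫ x : ℝ, (g x).re * Real.exp (-(x / 2)) with hA
  set B := ∫ x : ℝ, (g x).re * Real.exp (x / 2) with hB
  set s := ∫ x : ℝ, (g x).re with hs
  have hiA := pt_integrable_re_mul hg (φ := fun x ↦ Real.exp (-(x / 2))) (by fun_prop)
  have hiB := pt_integrable_re_mul hg (φ := fun x ↦ Real.exp (x / 2)) (by fun_prop)
  have his := pt_integrable_re hg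
  have key : ∀ c : ℝ, 0 ≤ A * (c * c) + (-2 * s) * c + B := by
    intro c
    have hpt : ∀ x : ℝ, (g x).re * (c * Real.exp (-(x / 4)) - Real.exp (x / 4)) ^ 2 =
        c * c * ((g x).re * Real.exp (-(x / 2))) - 2 * c * (g x).re + (g x).re * Real.exp (x / 2) := by
      intro x
      have h1 : Real.exp (-(x / 4)) * Real.exp (x / 4) = 1 := by
        rw [← Real.exp_add]; simp
      have h2 : Real.exp (-(x / 4)) ^ 2 = Real.exp (-(x / 2)) := by
        rw [sq, ← Real.exp_add]; ring_nf
      have h3 : Real.exp (x / 4) ^ 2 = Real.exp (x / 2) := by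
        rw [sq, ← Real.exp_add]; ring_nf
      have : (c * Real.exp (-(x / 4)) - Real.exp (x / 4)) ^ 2 =
          c * c * Real.exp (-(x / 4)) ^ 2 - 2 * c * (Real.exp (-(x / 4)) * Real.exp (x / 4)) +
            Real.exp (x / 4) ^ 2 := by ring
      rw [this, h1, h2, h3]; ring
    have hnn : 0 ≤ ∫ x : ℝ, (g x).re * (c * Real.exp (-(x / 4)) - Real.exp (x / 4)) ^ 2 :=
      integral_nonneg fun x ↦ mul_nonneg (hreal x).2 (sq_nonneg _)
    simp_rw [hpt] at hnn
    rw [integral_add, integral_sub, integral_const_mul, integral_const_mul] at hnn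
    · linarith
    all_goals first
      | exact (hiA.const_mul _).sub (his.const_mul _)
      | exact hiA.const_mul _
      | exact his.const_mul _
      | exact hiB
  have hd := discrim_le_zero key
  rw [discrim] at hd
  nlinarith

/-- **The polar term penalises one-signed states**: `2(∫ Re g)² ≤ 2 Re(ĝ(0) conj ĝ(1))` for a real
non-negative test (Yoshida (6.2) with `ε = +1`, plus Cauchy–Schwarz). [cite: Yoshida1992, §6 eq. (6.2)] -/
theorem pt_polar_ge_of_nonneg (hg : IsWeilTest g) (hreal : ∀ t, (g t).im = 0 ∧ 0 ≤ (g t).re) :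
    2 * (∫ x : ℝ, (g x).re) ^ 2 ≤ 2 * (weilMellin g 0 * conj (weilMellin g 1)).re := by
  rw [pt_weilMellin_zero_eq hreal, pt_weilMellin_one_eq hreal, Complex.conj_ofReal, ← Complex.ofReal_mul,
    Complex.ofReal_re]
  have := pt_sq_integral_re_le hg hreal
  linarith

/-! ## Lorentzian weights cost at most `(∫ g)²` each -/

/-- `∫ 2l/(l² + t²) dt = 2π` for `l > 0`. [folklore] -/
theorem pt_integral_lorentzian {l : ℝ} (hl : 0 < l) :
    ∫ t : ℝ, 2 * l / (l ^ 2 + t ^ 2) = 2 * π := by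
  have h : (fun t : ℝ ↦ 2 * l / (l ^ 2 + t ^ 2)) = fun t ↦ (2 / l) * (1 + (t / l) ^ 2)⁻¹ := by
    funext t
    have hl' : l ≠ 0 := hl.ne'
    field_simp
  rw [h, integral_const_mul, Measure.integral_comp_div (fun y : ℝ ↦ (1 + y ^ 2)⁻¹) l,
    integral_univ_inv_one_add_sq, abs_of_pos hl, smul_eq_mul]
  field_simp

/-- The Lorentzian is integrable. [folklore] -/
theorem pt_integrable_lorentzian {l : ℝ} (hl : 0 < l) :
    Integrable fun t : ℝ ↦ 2 * l / (l ^ 2 + t ^ 2) := by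
  have h : (fun t : ℝ ↦ 2 * l / (l ^ 2 + t ^ 2)) = fun t ↦ (2 / l) * (1 + (t / l) ^ 2)⁻¹ := by
    funext t
    have hl' : l ≠ 0 := hl.ne'
    field_simp
  rw [h]
  exact ((integrable_inv_one_add_sq.comp_div hl.ne').const_mul _)

/-- **Each Lorentzian costs at most `(∫g)²`**:
`(1/2π) ∫ ‖ĝ(1/2+it)‖² · 2l/(l²+t²) dt ≤ (∫ Re g)²` for a real non-negative test. [folklore] -/
theorem pt_integral_norm_sq_mul_lorentzian_le (hg : IsWeilTest g)
    (hreal : ∀ t, (g t).im = 0 ∧ 0 ≤ (g t).re) {l : ℝ} (hl : 0 < l) :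
    1 / (2 * π) * ∫ t : ℝ, ‖weilMellin g (1 / 2 + t * I)‖ ^ 2 * (2 * l / (l ^ 2 + t ^ 2)) ≤
      (∫ x : ℝ, (g x).re) ^ 2 := by
  set s := ∫ x : ℝ, (g x).re
  have hs0 : 0 ≤ s := integral_nonneg fun x ↦ (hreal x).2
  have hw : ∀ t : ℝ, 0 ≤ 2 * l / (l ^ 2 + t ^ 2) := fun t ↦ by positivity
  have hle : ∫ t : ℝ, ‖weilMellin g (1 / 2 + t * I)‖ ^ 2 * (2 * l / (l ^ 2 + t ^ 2)) ≤
      ∫ t : ℝ, s ^ 2 * (2 * l / (l ^ 2 + t ^ 2)) := by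
    refine integral_mono ?_ ((pt_integrable_lorentzian hl).const_mul _) fun t ↦ ?_
    · refine integrable_norm_sq_weilMellin_mul hg (by fun_prop) (A := 2 / l) (B := 0)
        (by positivity) le_rfl fun t ↦ ?_
      rw [abs_of_nonneg (hw t), zero_mul, add_zero, div_le_div_iff₀ (by positivity) hl]
      nlinarith [sq_nonneg t]
    · exact mul_le_mul_of_nonneg_right
        (pow_le_pow_left₀ (norm_nonneg _) (pt_norm_weilMellin_half_line_le hreal t) 2) (hw t)
  rw [integral_const_mul, pt_integral_lorentzian hl] at hle
  have hpi : 0 < 2 * π := by positivity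
  calc 1 / (2 * π) * ∫ t : ℝ, ‖weilMellin g (1 / 2 + t * I)‖ ^ 2 * (2 * l / (l ^ 2 + t ^ 2))
      ≤ 1 / (2 * π) * (s ^ 2 * (2 * π)) := mul_le_mul_of_nonneg_left hle (by positivity)
    _ = s ^ 2 := by field_simp


/-! ## The cone gap -/

/-- Pointwise minorant of the finite-prime weight by the first two terms of Yoshida's vertical series:
`w_N(t) ≥ ψ(1/4) + 24/5 − 2Ψ_N − 1/((1/2)²+t²)·(2·(1/2)) − (2·(5/2))/((5/2)²+t²)`
(`f_l(t) = 2/l − 2l/(l²+t²)` at `l = 1/2, 5/2`; `|ρ_N| ≤ 2Ψ_N`). [cite: Yoshida1992, §6 (vertical series)] -/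
theorem pt_weilFinitePrimeWeight_ge (N : ℕ) (t : ℝ) :
    reDigammaQuarter 0 + 24 / 5 -
        2 * (∑ n ∈ Finset.range (N + 1), (ArithmeticFunction.vonMangoldt n : ℝ) / Real.sqrt n) -
        2 * (1 / 2 : ℝ) / ((1 / 2 : ℝ) ^ 2 + t ^ 2) - 2 * (5 / 2 : ℝ) / ((5 / 2 : ℝ) ^ 2 + t ^ 2) ≤
      weilFinitePrimeWeight N t := by
  unfold weilFinitePrimeWeight
  have h1 := sum_digammaTerm_le 2 t
  rw [Finset.sum_range_succ, Finset.sum_range_succ, Finset.sum_range_zero, zero_add] at h1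
  have e0 : digammaNode 0 = 1 / 2 := by norm_num [digammaNode]
  have e1 : digammaNode 1 = 5 / 2 := by norm_num [digammaNode]
  rw [e0, e1, digammaTerm_eq (by norm_num) t, digammaTerm_eq (by norm_num) t] at h1
  have h2 := (abs_le.1 (pt_abs_weilPrimeRipple_le N t)).2
  norm_num at h1 h2 ⊢
  linarith

/-- **THE CONE GAP (finite-prime truncations).** For every `N` and every real non-negative Weil test `g`
(no support condition):
`E_N(g) ≥ (ψ(1/4) − log π + 24/5 − 2Ψ_N) ‖g‖₂²`, `Ψ_N = Σ_{n≤N} Λ(n)/√n`,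
while `ψ(1/4) − log π − 2Ψ_N = inf_t w_N(t) − log π` is the bottom of the symbol of `E_N`.
(Polar `≥ 2(∫g)²` by Cauchy–Schwarz; `|ĝ(1/2+it)| ≤ ∫g`; the symbol exceeds its infimum by the two
Lorentzian-complemented terms `f_{1/2} + f_{5/2}` of Yoshida's series, each Lorentzian costing `≤ (∫g)²`.) [cite: Yoshida1992, §2 eq. (2.1), §6] -/
theorem pt_weilFinitePrimeQuadratic_ge_of_nonneg (N : ℕ) (hg : IsWeilTest g)
    (hreal : ∀ t, (g t).im = 0 ∧ 0 ≤ (g t).re) :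
    (reDigammaQuarter 0 - Real.log π + 24 / 5 -
        2 * (∑ n ∈ Finset.range (N + 1), (ArithmeticFunction.vonMangoldt n : ℝ) / Real.sqrt n)) *
        weilNorm2Sq g ≤
      weilFinitePrimeQuadratic N g := by
  set Ψ := ∑ n ∈ Finset.range (N + 1), (ArithmeticFunction.vonMangoldt n : ℝ) / Real.sqrt n with hΨ
  set s := ∫ x : ℝ, (g x).re with hs
  set K := reDigammaQuarter 0 + 24 / 5 - 2 * Ψ with hK
  set F : ℝ → ℝ := fun t ↦ ‖weilMellin g (1 / 2 + t * I)‖ ^ 2 with hF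
  have hl0 : (0 : ℝ) < 1 / 2 := by norm_num
  have hl1 : (0 : ℝ) < 5 / 2 := by norm_num
  -- integrability
  have hiF : Integrable F := integrable_norm_sq_weilMellin_half_line hg
  have hiW : Integrable fun t ↦ F t * weilFinitePrimeWeight N t :=
    integrable_norm_sq_weilMellin_mul_weilFinitePrimeWeight hg N
  have hiL : ∀ {l : ℝ}, 0 < l → Integrable fun t ↦ F t * (2 * l / (l ^ 2 + t ^ 2)) := by
    intro l hl
    refine integrable_norm_sq_weilMellin_mul hg (by fun_prop) (A := 2 / l) (B := 0)
      (by positivity) le_rfl fun t ↦ ?_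
    have hw : 0 ≤ 2 * l / (l ^ 2 + t ^ 2) := by positivity
    rw [abs_of_nonneg hw, zero_mul, add_zero, div_le_div_iff₀ (by positivity) hl]
    nlinarith [sq_nonneg t]
  -- pointwise minorant, integrated
  have hpt : ∀ t, F t * K - F t * (2 * (1 / 2 : ℝ) / ((1 / 2 : ℝ) ^ 2 + t ^ 2)) -
      F t * (2 * (5 / 2 : ℝ) / ((5 / 2 : ℝ) ^ 2 + t ^ 2)) ≤ F t * weilFinitePrimeWeight N t := by
    intro t
    have h := pt_weilFinitePrimeWeight_ge N t
    have hF0 : 0 ≤ F t := sq_nonneg _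
    rw [← mul_sub, ← mul_sub]
    exact mul_le_mul_of_nonneg_left h hF0
  have hmono : ∫ t, (F t * K - F t * (2 * (1 / 2 : ℝ) / ((1 / 2 : ℝ) ^ 2 + t ^ 2)) -
      F t * (2 * (5 / 2 : ℝ) / ((5 / 2 : ℝ) ^ 2 + t ^ 2))) ≤ ∫ t, F t * weilFinitePrimeWeight N t :=
    integral_mono (((hiF.mul_const K).sub (hiL hl0)).sub (hiL hl1)) hiW hpt
  have hsplit : ∫ t, (F t * K - F t * (2 * (1 / 2 : ℝ) / ((1 / 2 : ℝ) ^ 2 + t ^ 2)) -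
      F t * (2 * (5 / 2 : ℝ) / ((5 / 2 : ℝ) ^ 2 + t ^ 2))) =
      2 * π * weilNorm2Sq g * K - (∫ t, F t * (2 * (1 / 2 : ℝ) / ((1 / 2 : ℝ) ^ 2 + t ^ 2))) -
        ∫ t, F t * (2 * (5 / 2 : ℝ) / ((5 / 2 : ℝ) ^ 2 + t ^ 2)) := by
    rw [integral_sub, integral_sub, integral_mul_const, integral_norm_sq_weilMellin_half_line hg]
    all_goals first
      | exact (hiF.mul_const K).sub (hiL hl0)
      | exact hiF.mul_const K
      | exact hiL hl0
      | exact hiL hl1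
  rw [hsplit] at hmono
  -- the pieces
  have hL0 := pt_integral_norm_sq_mul_lorentzian_le hg hreal hl0
  have hL1 := pt_integral_norm_sq_mul_lorentzian_le hg hreal hl1
  have hP := pt_polar_ge_of_nonneg hg hreal
  have hpi : 0 < 2 * π := by positivity
  unfold weilFinitePrimeQuadratic
  -- `(1/2π) ∫ F w_N ≥ K N₂ − 2 s²`
  have hA : K * weilNorm2Sq g - s ^ 2 - s ^ 2 ≤
      1 / (2 * π) * ∫ t, F t * weilFinitePrimeWeight N t := by
    have := mul_le_mul_of_nonneg_left hmono (le_of_lt (one_div_pos.2 hpi))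
    rw [mul_sub, mul_sub, show 1 / (2 * π) * (2 * π * weilNorm2Sq g * K) = K * weilNorm2Sq g by
      field_simp] at this
    linarith
  have hN : 0 ≤ weilNorm2Sq g := weilNorm2Sq_nonneg g
  nlinarith


/-! ## The prime-free case and the small-window Weil form -/

/-- For `N ≤ 1` there is no prime power: `ρ_N = 0` (`Λ(0) = Λ(1) = 0`). [folklore] -/
theorem pt_weilPrimeRipple_eq_zero {N : ℕ} (hN : N ≤ 1) (t : ℝ) : weilPrimeRipple N t = 0 := by
  unfold weilPrimeRipple
  refine Finset.sum_eq_zero fun n hn ↦ ?_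
  have hn' : n ≤ 1 := by have := Finset.mem_range.1 hn; omega
  interval_cases n <;> simp

/-- For `N ≤ 1` the finite-prime form IS Yoshida's prime-free form: `E_N = E = weilArchQuadratic`. [cite: Yoshida1992, §2 eq. (2.1)] -/
theorem pt_weilFinitePrimeQuadratic_eq_weilArchQuadratic {N : ℕ} (hN : N ≤ 1) (g : ℝ → ℂ) :
    weilFinitePrimeQuadratic N g = weilArchQuadratic g := by
  unfold weilFinitePrimeQuadratic weilArchQuadratic weilFinitePrimeWeight weilNorm2Sq reDigammaQuarter
  simp only [pt_weilPrimeRipple_eq_zero hN, sub_zero]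

/-- **THE CONE GAP, prime-free form.** Every real non-negative Weil test satisfies
`E(g) ≥ (ψ(1/4) − log π + 24/5) ‖g‖₂²` for Yoshida's polar + archimedean form `E = weilArchQuadratic`,
whose symbol bottom is `ψ(1/4) − log π` (approached by spread sign-changing even tests, part 2). [cite: Yoshida1992, §2 eq. (2.1), §6] -/
theorem pt_weilArchQuadratic_ge_of_nonneg (hg : IsWeilTest g) (hreal : ∀ t, (g t).im = 0 ∧ 0 ≤ (g t).re) :
    (reDigammaQuarter 0 - Real.log π + 24 / 5) * weilNorm2Sq g ≤ weilArchQuadratic g := by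
  have h := pt_weilFinitePrimeQuadratic_ge_of_nonneg 1 hg hreal
  rw [pt_weilFinitePrimeQuadratic_eq_weilArchQuadratic le_rfl] at h
  have h0 : ∑ n ∈ Finset.range (1 + 1), (ArithmeticFunction.vonMangoldt n : ℝ) / Real.sqrt n = 0 :=
    Finset.sum_eq_zero fun n hn ↦ by
      have hn' : n ≤ 1 := by have := Finset.mem_range.1 hn; omega
      interval_cases n <;> simp
  rw [h0, mul_zero, sub_zero] at h
  exact h

/-- Numerical form: `E(g) ≥ −0.5722 ‖g‖₂²` for every real non-negative Weil test
(`ψ(1/4) − log π ≥ −5.37218344`, tree). Contrast: the symbol bottom is `ψ(1/4) − log π ≤ −5.37`. [folklore] -/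
theorem pt_weilArchQuadratic_ge_of_nonneg_num (hg : IsWeilTest g) (hreal : ∀ t, (g t).im = 0 ∧ 0 ≤ (g t).re) :
    -0.5722 * weilNorm2Sq g ≤ weilArchQuadratic g := by
  have h := pt_weilArchQuadratic_ge_of_nonneg hg hreal
  have hc := re_digamma_one_quarter_sub_log_pi_ge
  rw [← reDigammaQuarter_zero] at hc
  have hN := weilNorm2Sq_nonneg g
  nlinarith

/-- **Small windows of the TRUE Weil form.** On the finite-prime cone `C((log(N+1))/2)` Weil's quadratic
functional equals `E_N` (tree, `weilQuadratic_re_eq_weilFinitePrimeQuadratic`), so every real non-negative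
test supported in `[−(log(N+1))/2, (log(N+1))/2]` has `Re Q(g) ≥ (ψ(1/4) − log π + 24/5 − 2Ψ_N)‖g‖₂²`. [cite: Yoshida1992, §2 eq. (2.1)] -/
theorem pt_weilQuadratic_re_ge_of_nonneg (N : ℕ) (hg : IsWeilTest g)
    (hsupp : tsupport g ⊆ Icc (-(Real.log ((N : ℝ) + 1) / 2)) (Real.log ((N : ℝ) + 1) / 2))
    (hreal : ∀ t, (g t).im = 0 ∧ 0 ≤ (g t).re) :
    (reDigammaQuarter 0 - Real.log π + 24 / 5 -
        2 * (∑ n ∈ Finset.range (N + 1), (ArithmeticFunction.vonMangoldt n : ℝ) / Real.sqrt n)) *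
        weilNorm2Sq g ≤
      (weilQuadratic g).re := by
  rw [weilQuadratic_re_eq_weilFinitePrimeQuadratic hg N hsupp]
  exact pt_weilFinitePrimeQuadratic_ge_of_nonneg N hg hreal

end Summit.RiemannHypothesis.RiemannHypothesis.Theorems.PolarPerronFrobenius
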